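import Summits.AtomisticToContinuum.FouriersLaw.Theses.VanishingNoiseTransfer
import Literature.MathematicalPhysics.KineticTheory.LangevinChainResolvent
import Literature.MathematicalPhysics.KineticTheory.LangevinSemigroupProofs
import Literature.MathematicalPhysics.KineticTheory.LangevinChainNESSProofs

/-!
# The resolvent of the pinned-chain semigroup at SMALL rates: uniform Lyapunov constants and the
distance to the steady state (helper for stub S2 `stub_fixedLengthNoiseContinuity`)

`--supports stmt-AtomisticToContinuum-11976` helper file (crux `VanishingNoiseBound`, route
`VanishingNoiseTransfer`, line `fekete-usc-one-length`, stub S2). First of the files proving input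
(P) of `FixedLengthNoiseContinuity.of_equidifferentiable_of_pointwise` — continuity of the unique
weak flip steady state of `L + εS` in the flip rate at `ε = 0⁺`, at fixed bath temperatures.

The flip steady state at rate `ε` is `π R_{Nε}` for the resolvent kernel
`R_r(z, ·) = ∫₀^∞ r e^{-rt} P_t(z, ·) dt` of the flip-free transition semigroup
(`pinnedChain_exists_resolventKernel`, `VelocityFlipSteadyStateExists.lean`) and an invariant law
`π` of the chain embedded at the flip times. Two facts about `R_r` for SMALL `r` are needed and
proved here (no new definitions):

* `abs_integral_resolvent_sub_le` — averaging an exponentially convergent orbit over the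
  exponential time: if `|P_t g(z) - m| ≤ A e^{-ct}` for all `t ≥ 0` then
  `|R_r g(z) - m| ≤ A · r/(r + c)` (→ 0 as `r → 0`), for any Langevin-chain semigroup;
* `exists_resolventKernel_uniform` — for `pinnedChain ω₂ lam β γ` (all parameters `> 0`), `N ≥ 2`,
  `T_L, T_R > 0`, `θ = 1/(2 max(T_L,T_R))`: the steady state `μ⋆` of the transition semigroup
  (CEHR 2018 Thm 2.13, `pinnedChainSemigroup_ergodic`, a weak `IsSteadyState`) and constants
  `a < 1`, `b < ∞`, `M ≥ 0` such that for EVERY rate `r ∈ (0, 1]` the resolvent kernel `R_r` is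
  Markov, satisfies the resolvent identity `R_r L = r(R_r - 1)` on `C_c^∞`, is Feller, obeys the
  contracting Lyapunov bound `R_r e^{θH} ≤ a e^{θH} + b` with the SAME `a, b` for all `r ≤ 1`
  (the proof of `pinnedChain_exists_resolventKernel` with the time step `t* = 1/(8(C + 2))` frozen
  at `r₀ = 1`), and `|R_r g(z) - μ⋆(g)| ≤ M r e^{θH(z)}` for every continuous `|g| ≤ e^{θH}`
  (CEHR (2.5) averaged over the exponential time).
-/

noncomputable section

namespace Summit.AtomisticToContinuum.FouriersLaw.Theorems.FixedLengthNoiseContinuity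

open MeasureTheory ProbabilityTheory Filter Topology Set
open scoped NNReal ENNReal ContDiff BoundedContinuousFunction
open Literature.MathematicalPhysics.KineticTheory.HeatConduction
open Literature.Probability.Process

/-! ## §1 Averaging an exponentially convergent orbit over an exponential time -/

/-- **The resolvent of an exponentially mixing orbit is close to the limit.** For a Langevin-chain
semigroup `S` with time-extended kernel `K (t, z) = P_{t⁺}(z, ·)` and the resolvent kernel
`R_r = K ∘ₖ (const Exp_r ×ₖ id)` (`R_r(z,·) = ∫₀^∞ r e^{-rt} P_t(z,·) dt`): if `g` is
`R_r(z,·)`-integrable and `|P_t g(z) - m| ≤ A e^{-ct}` for all `t ≥ 0` (`A ≥ 0`, `c > 0`), then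
`|R_r g(z) - m| ≤ A · r/(r + c)` — disintegrate `R_r`, bound the integrand, and
`∫₀^∞ r e^{-rt} e^{-ct} dt = r/(r + c)`. -/
theorem abs_integral_resolvent_sub_le {P : OscillatorChain} {N : ℕ} {T_L T_R : ℝ}
    (S : LangevinChainSemigroup P N T_L T_R)
    (K : Kernel (ℝ × PhaseSpace N) (PhaseSpace N)) [IsMarkovKernel K]
    (hK : ∀ (t : ℝ) (z : PhaseSpace N), K (t, z) = S.kernel t.toNNReal z)
    {r : ℝ} (hr : 0 < r) {g : PhaseSpace N → ℝ} (hgm : StronglyMeasurable g) (z : PhaseSpace N)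
    (hgi : Integrable g ((K ∘ₖ (Kernel.const _ (expMeasure r) ×ₖ Kernel.id)) z))
    {m A c : ℝ} (hA : 0 ≤ A) (hc : 0 < c)
    (hbound : ∀ t : ℝ≥0, |S.act t g z - m| ≤ A * Real.exp (-c * t)) :
    |∫ y, g y ∂((K ∘ₖ (Kernel.const _ (expMeasure r) ×ₖ Kernel.id)) z) - m| ≤
      A * (r / (r + c)) := by
  haveI := isProbabilityMeasure_expMeasure hr
  set ρ := expMeasure r with hρ
  set φ : ℝ → ℝ := fun t => S.act t.toNNReal g z with hφ
  -- (1) disintegration of the resolvent along the exponential time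
  have hKφ : (fun t : ℝ => ∫ y, g y ∂(K (t, z))) = φ := by
    funext t
    show ∫ y, g y ∂(K (t, z)) = S.act t.toNNReal g z
    rw [hK, LangevinChainSemigroup.act_apply]
  have h1 : ∫ y, g y ∂((K ∘ₖ (Kernel.const _ ρ ×ₖ Kernel.id)) z) = ∫ t, φ t ∂ρ := by
    rw [Kernel.integral_comp hgi, Kernel.prod_apply, Kernel.const_apply, Kernel.id_apply,
      Measure.prod_dirac, integral_map (by fun_prop)
        (hgm.integral_kernel (κ := K)).aestronglyMeasurable, ← hKφ]
  -- (2) the orbit is measurable and exponentially close to `m`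
  have hφm : StronglyMeasurable φ := by
    rw [← hKφ]
    exact (hgm.integral_kernel (κ := K)).comp_measurable (measurable_id.prodMk measurable_const)
  have hφb : ∀ t : ℝ, |φ t - m| ≤ A * Real.exp (-c * (t.toNNReal : ℝ)) := fun t =>
    hbound t.toNNReal
  have hexp1 : ∀ t : ℝ, Real.exp (-c * (t.toNNReal : ℝ)) ≤ 1 := fun t =>
    Real.exp_le_one_iff.2 (by nlinarith [(t.toNNReal).coe_nonneg, hc.le])
  have hφb' : ∀ t : ℝ, ‖φ t‖ ≤ |m| + A := fun t => by
    rw [Real.norm_eq_abs]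
    have h := (hφb t).trans (mul_le_of_le_one_right hA (hexp1 t))
    have := abs_sub_abs_le_abs_sub (φ t) m
    linarith
  have hφi : Integrable φ ρ :=
    (integrable_const (|m| + A)).mono' hφm.aestronglyMeasurable (Eventually.of_forall hφb')
  have h3 : ∫ t, φ t ∂ρ - m = ∫ t, (φ t - m) ∂ρ := by
    rw [integral_sub hφi (integrable_const _), integral_const, probReal_univ, one_smul]
  -- (3) the dominating function `A e^{-c t⁺}` and its exponential average
  have hbc : Continuous fun t : ℝ => A * Real.exp (-c * (t.toNNReal : ℝ)) :=
    continuous_const.mul (Real.continuous_exp.comp (continuous_const.mul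
      (NNReal.continuous_coe.comp continuous_real_toNNReal)))
  have hbi : Integrable (fun t : ℝ => A * Real.exp (-c * (t.toNNReal : ℝ))) ρ :=
    (integrable_const A).mono' hbc.aestronglyMeasurable (Eventually.of_forall fun t => by
      rw [Real.norm_eq_abs, abs_of_nonneg (by positivity)]
      exact mul_le_of_le_one_right hA (hexp1 t))
  have h4 : ‖∫ t, (φ t - m) ∂ρ‖ ≤ ∫ t, A * Real.exp (-c * (t.toNNReal : ℝ)) ∂ρ :=
    norm_integral_le_of_norm_le hbi (Eventually.of_forall fun t => by
      rw [Real.norm_eq_abs]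
      exact hφb t)
  have h5 : ∫ t, A * Real.exp (-c * (t.toNNReal : ℝ)) ∂ρ = A * (r / (r + c)) := by
    rw [hρ, integral_expMeasure_eq_integral_Ioi hr]
    have he : ∀ t ∈ Ioi (0 : ℝ), r * Real.exp (-(r * t)) * (A * Real.exp (-c * (t.toNNReal : ℝ))) =
        (A * r) * Real.exp (-(r + c) * t) := by
      intro t ht
      rw [Real.coe_toNNReal t (le_of_lt ht)]
      have h2 : Real.exp (-(r * t)) * Real.exp (-c * t) = Real.exp (-(r + c) * t) := by
        rw [← Real.exp_add]
        ring_nf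
      calc r * Real.exp (-(r * t)) * (A * Real.exp (-c * t))
          = (A * r) * (Real.exp (-(r * t)) * Real.exp (-c * t)) := by ring
        _ = (A * r) * Real.exp (-(r + c) * t) := by rw [h2]
    rw [setIntegral_congr_fun measurableSet_Ioi he, integral_const_mul,
      integral_exp_mul_Ioi (by linarith : -(r + c) < 0) 0, mul_zero, Real.exp_zero,
      neg_div_neg_eq, one_div, div_eq_mul_inv, mul_assoc]
  rw [h1, h3, ← Real.norm_eq_abs]
  exact h4.trans (le_of_eq h5)

/-! ## §2 The resolvent kernels of the pinned chain at rates `r ≤ 1` -/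

section Pinned

variable {ω₂ lam β γ : ℝ} {N : ℕ} {T_L T_R : ℝ}

/-- **Resolvent kernels of the pinned chain at small rates: uniform constants and the distance to
the steady state.** For `pinnedChain ω₂ lam β γ` (`ω₂, lam, β, γ > 0`), `N ≥ 2`, `T_L, T_R > 0`
and `θ = 1/(2 max(T_L, T_R))` there are: the steady state `μ⋆` of the transition semigroup
`pinnedChainSemigroup` (a probability measure and a weak steady state, `OscillatorChain.IsSteadyState`),
constants `a < 1`, `b < ∞` and `M ≥ 0`, such that for every rate `0 < r ≤ 1` there is a Markov
kernel `R` (the resolvent `R_r(z,·) = ∫₀^∞ r e^{-rt} P_t(z,·) dt`) with (i) the resolvent identity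
`∫ Lf dR(z,·) = r (∫ f dR(z,·) - f z)` on `C_c^∞`; (ii) the Feller property; (iii) the contracting
Lyapunov bound `∫ e^{θH} dR(z,·) ≤ a e^{θH(z)} + b` with `a, b` INDEPENDENT of `r ≤ 1` (proof of
`pinnedChain_exists_resolventKernel` with the time step frozen at `t* = 1/(8(C + 2))`,
`C = θγ(T_L + T_R)`: `a ≤ e^{Ct*}(t* + 1/2) < 1`); (iv) `|∫ g dR(z,·) - ∫ g dμ⋆| ≤ M r e^{θH(z)}`
for every continuous `g` with `|g| ≤ e^{θH}` (CEHR 2018 (2.5), `pinnedChainSemigroup_ergodic`,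
averaged: `abs_integral_resolvent_sub_le`, `M = C_{2.5}/c_{2.5}`). -/
theorem exists_resolventKernel_uniform (hω : 0 < ω₂) (hl : 0 < lam) (hβ : 0 < β) (hγ : 0 < γ)
    (hN : 1 < N) (hTL : 0 < T_L) (hTR : 0 < T_R) :
    ∃ μs : Measure (PhaseSpace N), IsProbabilityMeasure μs ∧
      (pinnedChain ω₂ lam β γ).IsSteadyState N T_L T_R μs ∧
      ∃ (a b : ℝ≥0∞) (M : ℝ), a < 1 ∧ b ≠ ⊤ ∧ 0 ≤ M ∧
        ∀ r : ℝ, 0 < r → r ≤ 1 →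
          ∃ R : Kernel (PhaseSpace N) (PhaseSpace N), IsMarkovKernel R ∧
            (∀ f : PhaseSpace N → ℝ, ContDiff ℝ ∞ f → HasCompactSupport f → ∀ z : PhaseSpace N,
              ∫ y, (pinnedChain ω₂ lam β γ).generator N T_L T_R f y ∂(R z) =
                r * (∫ y, f y ∂(R z) - f z)) ∧
            (∀ g : PhaseSpace N →ᵇ ℝ, Continuous fun z => ∫ y, g y ∂(R z)) ∧
            (∀ z : PhaseSpace N,
              ∫⁻ y, ENNReal.ofReal (Real.exp (1 / max T_L T_R / 2 *
                  (pinnedChain ω₂ lam β γ).hamiltonian N y)) ∂(R z) ≤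
                a * ENNReal.ofReal (Real.exp (1 / max T_L T_R / 2 *
                  (pinnedChain ω₂ lam β γ).hamiltonian N z)) + b) ∧
            (∀ g : PhaseSpace N → ℝ, Continuous g →
              (∀ y, |g y| ≤ Real.exp (1 / max T_L T_R / 2 *
                (pinnedChain ω₂ lam β γ).hamiltonian N y)) →
              ∀ z : PhaseSpace N, |∫ y, g y ∂(R z) - ∫ y, g y ∂μs| ≤
                M * r * Real.exp (1 / max T_L T_R / 2 *
                  (pinnedChain ω₂ lam β γ).hamiltonian N z)) := by
  -- adapted from `pinnedChain_exists_resolventKernel`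
  -- (Literature/MathematicalPhysics/KineticTheory/LangevinChainResolvent.lean): same construction,
  -- time step frozen at `r₀ = 1`, plus the steady state and clause (iv)
  have hN0 : 0 < N := by omega
  set P := pinnedChain ω₂ lam β γ
  set θ : ℝ := 1 / max T_L T_R / 2 with hθdef
  have hmax : 0 < max T_L T_R := lt_max_of_lt_left hTL
  have hθ : 0 < θ := by positivity
  have hθ' : θ < 1 / max T_L T_R := half_lt_self (by positivity)
  set Sg := pinnedChainSemigroup hω hl.le hβ.le hγ.le hN0 hTL.le hTR.le
  -- the steady state of the semigroup and the exponential convergence (2.5) at weight `e^{θH}`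
  obtain ⟨-, μs, hμs, hinv, hrest⟩ := pinnedChainSemigroup_ergodic hω hl.le hβ hγ hN0 hTL hTR
  obtain ⟨hint, C25, c25, hC25, hc25, h25⟩ := hrest θ hθ hθ'
  haveI := hμs
  have hss : P.IsSteadyState N T_L T_R μs :=
    pinnedChain_isSteadyState_of_isInvariant hω.le hl.le hβ.le γ N Sg hinv hθ hint
  -- the time-extended kernel
  let K : Kernel (ℝ × PhaseSpace N) (PhaseSpace N) := ⟨fun p => Sg.kernel p.1.toNNReal p.2,
    Measurable.comp (g := fun q : ℝ≥0 × PhaseSpace N => Sg.kernel q.1 q.2)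
      (f := fun p : ℝ × PhaseSpace N => (p.1.toNNReal, p.2)) Sg.measurable_kernel (by fun_prop)⟩
  haveI hKM : IsMarkovKernel K :=
    ⟨fun p => by change IsProbabilityMeasure (Sg.kernel p.1.toNNReal p.2); infer_instance⟩
  have hK : ∀ (t : ℝ) (z : PhaseSpace N), K (t, z) = Sg.kernel t.toNNReal z := fun t z => rfl
  -- Lyapunov constants, with the time step frozen at `r₀ = 1`
  set Cst : ℝ := θ * γ * (T_L + T_R) with hCst
  have hCst0 : 0 ≤ Cst := by positivity
  set ts : ℝ := 1 / (8 * (Cst + 1 + 1)) with hts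
  have hts0 : 0 < ts := by positivity
  have hkey : (Cst + 1 + 1) * ts = 1 / 8 := by rw [hts]; field_simp
  have hCts : Cst * ts ≤ 1 / 8 := hkey ▸ mul_le_mul_of_nonneg_right (by linarith) hts0.le
  have h1ts : ts ≤ 1 / 8 := by
    have : 1 * ts ≤ (Cst + 1 + 1) * ts := mul_le_mul_of_nonneg_right (by linarith) hts0.le
    linarith
  set tstar : ℝ≥0 := ⟨ts, hts0.le⟩
  have htsco : ((tstar : ℝ≥0) : ℝ) = ts := rfl
  have hts0' : (0 : ℝ≥0) < tstar := by rw [← NNReal.coe_lt_coe]; exact hts0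
  set V : PhaseSpace N → ℝ≥0∞ := fun y => ENNReal.ofReal (Real.exp (θ * P.hamiltonian N y)) with hV
  have hVm : Measurable V := ENNReal.measurable_ofReal.comp (Real.measurable_exp.comp
    ((pinnedChain_continuous_hamiltonian ω₂ lam β γ N).measurable.const_mul _))
  have h34 := lintegral_exp_mul_hamiltonian_pinnedChainSemigroup_le hω hl.le hβ.le hγ.le hN0 hTL.le
    hTR.le hTL hTR hθ hθ'
  obtain ⟨E₀, hE₀⟩ := pinnedChain_lintegral_exp_hamiltonian_small hω hl hβ hγ hN hTL hTR hθ hθ'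
    (tstar := (tstar : ℝ)) (by rw [htsco]; exact hts0)
  set c₀ : ℝ := Real.exp (Cst * ts) * Real.exp (θ * E₀) with hc₀
  set a₀ : ℝ≥0∞ := ENNReal.ofReal (1 / 2) with ha₀
  have hH2 : ∀ x, ∫⁻ y, V y ∂(Sg.kernel tstar x) ≤ a₀ * V x + ENNReal.ofReal c₀ := by
    intro x
    change ∫⁻ y, V y ∂(P.transitionKernel N T_L T_R tstar x) ≤ _
    by_cases hx : P.hamiltonian N x ≤ E₀
    · refine (h34 tstar x).trans (le_add_left (ENNReal.ofReal_le_ofReal ?_))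
      rw [hc₀, htsco]
      exact mul_le_mul_of_nonneg_left (Real.exp_le_exp.2 (mul_le_mul_of_nonneg_left hx hθ.le))
        (Real.exp_pos _).le
    · rw [pinnedChain_lintegral_transitionKernel hω hl.le hβ.le hγ.le N T_L T_R tstar x hVm]
      refine (hE₀ x (le_of_not_ge hx)).trans (le_add_right (le_of_eq ?_))
      rw [ha₀, hV, ← ENNReal.ofReal_mul (by norm_num)]
      congr 1; ring
  set c : ℝ≥0∞ := ENNReal.ofReal (Real.exp (Cst * ts)) with hc
  have hloc : ∀ u : ℝ≥0, u < tstar → ∀ x, ∫⁻ y, V y ∂(Sg.kernel u x) ≤ c * V x := by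
    intro u hu x
    refine (h34 u x).trans ?_
    rw [hc, hV, ← ENNReal.ofReal_mul (by positivity)]
    refine ENNReal.ofReal_le_ofReal (mul_le_mul_of_nonneg_right (Real.exp_le_exp.2 ?_) (by positivity))
    have hu' : ((u : ℝ≥0) : ℝ) ≤ ts := by rw [← htsco]; exact_mod_cast hu.le
    rw [hCst]
    nlinarith [u.coe_nonneg]
  have ha₀1 : a₀ < 1 := ENNReal.ofReal_lt_one.2 (by norm_num)
  obtain ⟨B, hBtop, hB⟩ := MarkovSemigroup.exists_fixedBound ha₀1 ENNReal.ofReal_ne_top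
  have hunif : ∀ (t : ℝ≥0) x, ∫⁻ y, V y ∂(Sg.kernel t x) ≤ c * V x + B := fun t x =>
    MarkovSemigroup.lintegral_kernel_le_of_lyapunov Sg.kernel Sg.kernel_zero Sg.kernel_add hVm hts0'
      ha₀1.le hB hH2 hloc t x
  -- the uniform constants
  refine ⟨μs, hμs, hss, c * ENNReal.ofReal ts + c * a₀, B + (c * ENNReal.ofReal c₀ + B),
    C25 / c25, ?_, ?_, by positivity, fun r hr hr1 => ?_⟩
  · rw [hc, ha₀, ← ENNReal.ofReal_mul (Real.exp_pos _).le, ← ENNReal.ofReal_mul (Real.exp_pos _).le,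
      ← ENNReal.ofReal_add (by positivity) (by positivity), ENNReal.ofReal_lt_one]
    have h1 : Real.exp (Cst * ts) * (1 - Cst * ts) ≤ 1 := by
      have := Real.add_one_le_exp (-(Cst * ts))
      calc Real.exp (Cst * ts) * (1 - Cst * ts) ≤ Real.exp (Cst * ts) * Real.exp (-(Cst * ts)) :=
            mul_le_mul_of_nonneg_left (by linarith) (Real.exp_pos _).le
        _ = 1 := by rw [← Real.exp_add, add_neg_cancel, Real.exp_zero]
    nlinarith [Real.exp_pos (Cst * ts), mul_nonneg hCst0 hts0.le]
  · exact ENNReal.add_ne_top.2 ⟨hBtop, ENNReal.add_ne_top.2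
      ⟨ENNReal.mul_ne_top ENNReal.ofReal_ne_top ENNReal.ofReal_ne_top, hBtop⟩⟩
  -- the resolvent kernel at rate `r`
  haveI := isProbabilityMeasure_expMeasure hr
  set ρ := expMeasure r
  have hly : ∀ z : PhaseSpace N, ∫⁻ y, V y ∂((K ∘ₖ (Kernel.const (PhaseSpace N) ρ ×ₖ Kernel.id)) z) ≤
      (c * ENNReal.ofReal ts + c * a₀) * V z + (B + (c * ENNReal.ofReal c₀ + B)) := by
    intro z
    have h₁ : ∀ t : ℝ, ∫⁻ y, V y ∂(K (t, z)) ≤ c * V z + B := fun t => hunif t.toNNReal z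
    have h₂ : ∀ t : ℝ, ts ≤ t →
        ∫⁻ y, V y ∂(K (t, z)) ≤ c * a₀ * V z + (c * ENNReal.ofReal c₀ + B) := fun t ht =>
      Sg.lintegral_kernel_le_of_tstar_le K hK hVm hH2 hunif (by rw [htsco]; exact ht) z
    refine (lintegral_comp_const_prod_id_le K ρ z hVm ts h₁ h₂).trans ?_
    gcongr
    refine (expMeasure_Iio_le hr hts0.le).trans (ENNReal.ofReal_le_ofReal ?_)
    calc r * ts ≤ 1 * ts := mul_le_mul_of_nonneg_right hr1 hts0.le
      _ = ts := one_mul ts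
  refine ⟨K ∘ₖ (Kernel.const (PhaseSpace N) ρ ×ₖ Kernel.id), inferInstance, fun f hf hfc z =>
    Sg.integral_generator_comp_const_prod_id K hK (pinnedChain_contDiff_U ω₂ lam β γ)
      (pinnedChain_contDiff_V ω₂ lam β γ) hr hf hfc z, fun g => Sg.continuous_integral_comp_const_prod_id
      K hK ρ (continuous_act_pinnedChainSemigroup hω hl.le hβ.le hγ.le hN0 hTL.le hTR.le) g, hly, ?_⟩
  -- (iv) the distance to the steady state, `abs_integral_resolvent_sub_le`
  intro g hg hgb z
  have hVz : ∫⁻ y, V y ∂((K ∘ₖ (Kernel.const (PhaseSpace N) ρ ×ₖ Kernel.id)) z) < ⊤ := by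
    refine (hly z).trans_lt (ENNReal.add_lt_top.2 ⟨ENNReal.mul_lt_top ?_ ENNReal.ofReal_lt_top, ?_⟩)
    · exact ENNReal.add_lt_top.2 ⟨ENNReal.mul_lt_top ENNReal.ofReal_lt_top ENNReal.ofReal_lt_top,
        ENNReal.mul_lt_top ENNReal.ofReal_lt_top ENNReal.ofReal_lt_top⟩
    · exact ENNReal.add_lt_top.2 ⟨hBtop.lt_top, ENNReal.add_lt_top.2
        ⟨ENNReal.mul_lt_top ENNReal.ofReal_lt_top ENNReal.ofReal_lt_top, hBtop.lt_top⟩⟩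
  have hexpi : Integrable (fun y => Real.exp (θ * P.hamiltonian N y))
      ((K ∘ₖ (Kernel.const (PhaseSpace N) ρ ×ₖ Kernel.id)) z) := by
    refine ⟨(Real.continuous_exp.comp (continuous_const.mul
      (pinnedChain_continuous_hamiltonian ω₂ lam β γ N))).aestronglyMeasurable, ?_⟩
    show ∫⁻ y, ‖Real.exp (θ * P.hamiltonian N y)‖ₑ
      ∂((K ∘ₖ (Kernel.const (PhaseSpace N) ρ ×ₖ Kernel.id)) z) < ⊤
    simp only [Real.enorm_eq_ofReal (Real.exp_nonneg _)]
    exact hVz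
  have hgi : Integrable g ((K ∘ₖ (Kernel.const (PhaseSpace N) ρ ×ₖ Kernel.id)) z) :=
    hexpi.mono' hg.aestronglyMeasurable (Eventually.of_forall fun y => by
      rw [Real.norm_eq_abs]; exact hgb y)
  have hA : 0 ≤ C25 * Real.exp (θ * P.hamiltonian N z) := by positivity
  have hb : ∀ t : ℝ≥0, |Sg.act t g z - ∫ y, g y ∂μs| ≤
      C25 * Real.exp (θ * P.hamiltonian N z) * Real.exp (-c25 * t) := fun t => h25 z t g hg hgb
  have key := abs_integral_resolvent_sub_le Sg K hK hr hg.stronglyMeasurable z hgi hA hc25 hb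
  refine key.trans ?_
  have hrc : r / (r + c25) ≤ r / c25 :=
    div_le_div_of_nonneg_left hr.le hc25 (by linarith)
  calc C25 * Real.exp (θ * P.hamiltonian N z) * (r / (r + c25))
      ≤ C25 * Real.exp (θ * P.hamiltonian N z) * (r / c25) :=
        mul_le_mul_of_nonneg_left hrc hA
    _ = C25 / c25 * r * Real.exp (θ * P.hamiltonian N z) := by ring

/-- Registered helper sub-goal `helper_flipResolventUniform` of stmt-AtomisticToContinuum-11976
(= `exists_resolventKernel_uniform`, fully quantified, notation-free one-line form). -/
theorem helper_flipResolventUniform : ∀ (ω₂ lam β γ : ℝ), 0 < ω₂ → 0 < lam → 0 < β → 0 < γ → ∀ (N : ℕ) (T_L T_R : ℝ), 1 < N → 0 < T_L → 0 < T_R → ∃ μs : MeasureTheory.Measure (Literature.MathematicalPhysics.KineticTheory.HeatConduction.PhaseSpace N), MeasureTheory.IsProbabilityMeasure μs ∧ (Literature.MathematicalPhysics.KineticTheory.HeatConduction.pinnedChain ω₂ lam β γ).IsSteadyState N T_L T_R μs ∧ ∃ (a b : ENNReal) (M : ℝ), a < 1 ∧ b ≠ (⊤ : ENNReal) ∧ 0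 ≤ M ∧ ∀ r : ℝ, 0 < r → r ≤ 1 → ∃ R : ProbabilityTheory.Kernel (Literature.MathematicalPhysics.KineticTheory.HeatConduction.PhaseSpace N) (Literature.MathematicalPhysics.KineticTheory.HeatConduction.PhaseSpace N), ProbabilityTheory.IsMarkovKernel R ∧ (∀ f : Literature.MathematicalPhysics.KineticTheory.HeatConduction.PhaseSpace N → ℝ, ContDiff ℝ ((⊤ : ℕ∞) : WithTop ℕ∞) f → HasCompactSupport f → ∀ z : Literature.MathematicalPhysics.KineticTheory.HeatConduction.PhaseSpace N, MeasureTheory.integral (R z) (fun y => (Literature.MathematicalPhysics.KineticTheory.HeatConduction.pinnedChain ω₂ lam β γ).generator N T_L T_R f y) = r * (MeasureTheory.integral (R z) (fun y => f y) - f z)) ∧ (∀ g : BoundedContinuousFunction (Literature.MathematicalPhysics.KineticTheory.HeatConduction.PhaseSpace N) ℝ, Continuous fun z => MeasureTheory.integral (R z) (fun y => g y)) ∧ (∀ z : Literature.MathematicalPhysics.KineticTheory.HeatConduction.PhaseSpace N, MeasureTheory.lintegral (R z) (fun y => ENNReal.ofReal (Real.exp (1 / max T_L T_R / 2 * (Literature.MathematicalPhysics.KineticTheory.HeatConduction.pinnedChain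 ω₂ lam β γ).hamiltonian N y))) ≤ a * ENNReal.ofReal (Real.exp (1 / max T_L T_R / 2 * (Literature.MathematicalPhysics.KineticTheory.HeatConduction.pinnedChain ω₂ lam β γ).hamiltonian N z)) + b) ∧ (∀ g : Literature.MathematicalPhysics.KineticTheory.HeatConduction.PhaseSpace N → ℝ, Continuous g → (∀ y, |g y| ≤ Real.exp (1 / max T_L T_R / 2 * (Literature.MathematicalPhysics.KineticTheory.HeatConduction.pinnedChain ω₂ lam β γ).hamiltonian N y)) → ∀ z : Literature.MathematicalPhysics.KineticTheory.HeatConduction.PhaseSpace N, |MeasureTheory.integral (R z) (fun y => g y) - MeasureTheory.integral μs (fun y => g y)| ≤ M * r * Real.exp (1 / max T_L T_R / 2 * (Literature.MathematicalPhysics.KineticTheory.HeatConduction.pinnedChain ω₂ lam β γ).hamiltonian N z)) :=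
  fun _ _ _ _ hω hl hβ hγ _ _ _ hN hTL hTR => exists_resolventKernel_uniform hω hl hβ hγ hN hTL hTR

end Pinned

end Summit.AtomisticToContinuum.FouriersLaw.Theorems.FixedLengthNoiseContinuity

end
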